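import Mathlib
import HarnessLib
import Literature.Computability.AlgebraicComplexity.TensorRestrictionRank
import Literature.Computability.AlgebraicComplexity.CoppersmithWinograd1990Proofs
import Summits.MatrixMultiplication.MatrixMultiplication.Theses.OutsiderSandwich
import Summits.MatrixMultiplication.MatrixMultiplication.Theorems.OutsiderSandwichLaserMergeCore

/-!
# OutsiderSandwich — the packing profile, II: TOP ⟹ LNT and the laser endpoint
(decomp-mm lens 4 «minimal-counterexample / extremal reduction», gen 9; companion of
`OutsiderSandwichPackingProfile.lean`, which holds the plumbing and the re-glue LNT ∧ BOTTOM ⟹ ω = 2;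
this file imports neither it nor any other module that imports the route file — only the
route-free `OutsiderSandwichLaserMergeCore` for the laser zeroing `laserBlocks`)

Two route items of `OutsiderSandwich` (rev 9) proved BY NAME:
* `PerfectBeyondLaserOfMMPerfect` (stmt-MatrixMultiplication-31795): TOP = `CwTwoMMPerfect` ⟹
  LNT = `PerfectBeyondLaser`, with `B = 1`, `γ = 1/12` (a single perfect product `⟨m,m,m⟩ ≤ cw₂^{⊠N}`,
  `m² ≥ 3^{(1-ε)N}`, has block side `m ≥ 2^{(5/12)N}` once `ε ≤ 1/10`) — so LNT is WEAKER than TOP;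
* `PerfectAtLaser` (stmt-MatrixMultiplication-31794): the `γ = 0` endpoint of LNT is a THEOREM — the
  laser zeroing-out of `cw₂^{⊠3k}` (BCS Thm. 15.41, tree `CoppersmithWinograd1990Proofs`) is a perfect
  packing `⟨p_k⟩ ⊗ ⟨2^k,2^k,2^k⟩` with `p_k · 4^k ≥ 27^{(1-o(1))k}`, i.e. block side exactly `2^{N/3}`
  (tree `OutsiderSandwichLaserMerge.laserBlocks`, here `perfectAtLaser`).
Sources: BurgisserClausenShokrollahi1997 (Thm. 15.41, p. 381), CoppersmithWinograd1990 (§6),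
Strassen1987.
-/

set_option linter.dupNamespace false

namespace Summit.MatrixMultiplication.MatrixMultiplication.Theorems.OutsiderSandwichPackingProfileLaser

open scoped BigOperators
open Literature.Computability.AlgebraicComplexity
open Summit.MatrixMultiplication.MatrixMultiplication.Theses.OutsiderSandwich
  (CwTwoMMPerfect LaserMergeOptimal PerfectBeyondLaser PerfectAtLaser PerfectBeyondLaserOfMMPerfect
    SummitOfPerfectBeyondLaser)
open Summit.MatrixMultiplication.MatrixMultiplication.Theorems.OutsiderSandwichLaserMerge (laserBlocks)

/-! ## TOP ⟹ LNT -/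

/-- **TOP ⟹ LNT** with `γ = 1/12` and `B = 1`: a single perfect product has block side
`m ≥ 3^{(1-ε)N/2} ≥ 2^{(5/12)N}` once `ε ≤ 1/10`. [this route, g9] -/
theorem perfectBeyondLaser_of_cwTwoMMPerfect (h : CwTwoMMPerfect) : PerfectBeyondLaser := by
  refine ⟨1 / 12, by norm_num, fun ε hε N₀ => ?_⟩
  have hε' : 0 < min ε (1 / 10) := lt_min hε (by norm_num)
  obtain ⟨N, hN, m, hres, hcap⟩ := h (min ε (1 / 10)) hε' N₀
  have hlog2 : 0 < Real.log 2 := Real.log_pos one_lt_two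
  have hlog23 : Real.log 2 ≤ Real.log 3 := Real.log_le_log two_pos (by norm_num)
  have hn0 : (0 : ℝ) ≤ N := Nat.cast_nonneg N
  have h3pos : (0 : ℝ) < (3 : ℝ) ^ ((1 - min ε (1 / 10)) * N) := Real.rpow_pos_of_pos (by norm_num) _
  have hm0 : (0 : ℝ) < m := by
    have : (0 : ℝ) < (m : ℝ) ^ 2 := lt_of_lt_of_le h3pos hcap
    rcases (Nat.eq_zero_or_pos m) with h0 | h0
    · rw [h0] at this; simp at this
    · exact_mod_cast h0
  refine ⟨N, hN, 1, m, ?_, ?_, ?_⟩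
  · -- `⟨m,m,m⟩ ≥ ⟨1⟩ ⊗ ⟨m,m,m⟩` by the relabelling `Fin 1 × X ≃ X` (as in part I)
    have hunit : TensorRestrictsTo (matMulTensor ℂ m m m)
        (kroneckerTensor (unitTensor ℂ 1) (matMulTensor ℂ m m m)) := by
      classical
      set s := kroneckerTensor (unitTensor ℂ 1) (matMulTensor ℂ m m m) with hs
      have e : matMulTensor ℂ m m m = fun a b c =>
          s ((Equiv.uniqueProd (Fin m × Fin m) (Fin 1)).symm a)
            ((Equiv.uniqueProd (Fin m × Fin m) (Fin 1)).symm b)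
            ((Equiv.uniqueProd (Fin m × Fin m) (Fin 1)).symm c) := by
        funext a b c
        simp [hs, kroneckerTensor_apply]
      rw [e]
      exact tensorRestrictsTo_of_reindex s _ _ _
    exact hres.trans hunit
  · rw [Nat.cast_one, one_mul]
    refine le_trans ?_ hcap
    exact Real.rpow_le_rpow_of_exponent_le (by norm_num)
      (mul_le_mul_of_nonneg_right (by linarith [min_le_left ε (1 / 10)]) hn0)
  · have hL : (1 - min ε (1 / 10)) * N * Real.log 3 ≤ 2 * Real.log m := by
      have := Real.log_le_log h3pos hcap
      rwa [Real.log_rpow (by norm_num), Real.log_pow] at this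
    have hmin : min ε (1 / 10) ≤ 1 / 10 := min_le_right _ _
    rw [← Real.log_le_log_iff (Real.rpow_pos_of_pos two_pos _) hm0, Real.log_rpow two_pos]
    have h1 : (N : ℝ) * Real.log 2 ≤ N * Real.log 3 := mul_le_mul_of_nonneg_left hlog23 hn0
    have h2 : 0 ≤ (1 / 10 - min ε (1 / 10)) * (N * Real.log 3) :=
      mul_nonneg (by linarith) (mul_nonneg hn0 (by linarith))
    nlinarith [h1, h2, hL, mul_nonneg hn0 hlog2.le]

/-! ## The laser endpoint `γ = 0` is a theorem -/

/-- **`PerfectAtLaser` holds**: `N = 3k`, `B = p_k`, `m = 2^k`, with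
`log(p_k 4^k) ≥ 3k log 3 − 12√k − log 96 ≥ (1−ε)·3k·log 3` for `k` large.
[cite: BurgisserClausenShokrollahi1997, Thm. 15.41 (proof, p. 381)] -/
theorem perfectAtLaser : PerfectAtLaser := by
  intro ε hε N₀
  have hlog3 : 0 < Real.log 3 := Real.log_pos (by norm_num)
  obtain ⟨k₀, hk₀⟩ := exists_nat_forall_sqrt_le 12 (Real.log 96) (3 * ε * Real.log 3) (by positivity)
  obtain ⟨k, hk⟩ : ∃ k : ℕ, k = max k₀ (max N₀ 1) := ⟨_, rfl⟩
  have hk1 : 1 ≤ k := by rw [hk]; omega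
  have hkk₀ : k₀ ≤ k := by rw [hk]; omega
  have hkN₀ : N₀ ≤ k := by rw [hk]; omega
  obtain ⟨p, hp0, hlogp, hres⟩ := laserBlocks k hk1
  refine ⟨3 * k, by omega, p, 2 ^ k, hres, ?_, ?_⟩
  · have hthr := hk₀ k hkk₀
    have h274 : Real.log (27 / 4) = 3 * Real.log 3 - 2 * Real.log 2 := by
      rw [show (27 : ℝ) / 4 = 3 ^ 3 / 2 ^ 2 by norm_num, Real.log_div (by norm_num) (by norm_num),
        Real.log_pow, Real.log_pow]; push_cast; ring
    rw [h274] at hlogp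
    have h2k : (0 : ℝ) < ((2 ^ k : ℕ) : ℝ) := by positivity
    have h3 : (0 : ℝ) < (3 : ℝ) ^ ((1 - ε) * ((3 * k : ℕ) : ℝ)) := Real.rpow_pos_of_pos (by norm_num) _
    have lhs : Real.log ((3 : ℝ) ^ ((1 - ε) * ((3 * k : ℕ) : ℝ))) = (1 - ε) * (3 * k) * Real.log 3 := by
      rw [Real.log_rpow (by norm_num)]; push_cast; ring
    have rhs : Real.log ((p : ℝ) * ((2 ^ k : ℕ) : ℝ) ^ 2) = Real.log p + 2 * k * Real.log 2 := by
      rw [Real.log_mul hp0.ne' (pow_pos h2k 2).ne', Real.log_pow]; push_cast; rw [Real.log_pow]; ring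
    rw [← Real.log_le_log_iff h3 (mul_pos hp0 (pow_pos h2k 2)), lhs, rhs]
    have hk0 : (0 : ℝ) ≤ k := Nat.cast_nonneg k
    nlinarith [hlogp, hthr, hlog3, Real.log_pos one_lt_two, hε, mul_nonneg hk0 hlog3.le,
      mul_nonneg (mul_nonneg hε.le hk0) hlog3.le]
  · have e : (((3 * k : ℕ) : ℝ) / 3) = (k : ℝ) := by push_cast; ring
    rw [e, Real.rpow_natCast]; push_cast; exact le_rfl

/-! ## The route items, by name (rev 9) -/

/-- **Item `OutsiderSandwich.PerfectBeyondLaserOfMMPerfect` (stmt-MatrixMultiplication-31795) holds**: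
`CwTwoMMPerfect → PerfectBeyondLaser`. [this route, g9] -/
theorem perfectBeyondLaserOfMMPerfect_holds : PerfectBeyondLaserOfMMPerfect :=
  perfectBeyondLaser_of_cwTwoMMPerfect

/-- **Item `OutsiderSandwich.PerfectAtLaser` (stmt-MatrixMultiplication-31794) holds**: the laser
endpoint `γ = 0` of the packing profile. [this route, g9] -/
theorem perfectAtLaser_holds : PerfectAtLaser := perfectAtLaser

end Summit.MatrixMultiplication.MatrixMultiplication.Theorems.OutsiderSandwichPackingProfileLaser
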